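import Mathlib
import HarnessLib
import HarnessLib.Audit
import Summits.Langlands.Statement
import HarnessLib.Audit.Check
import Literature.NumberTheory.Automorphic.HyperbolicLaplaceSpectrum
import Literature.NumberTheory.GaloisRepresentations.EvenGaloisRep
import Literature.NumberTheory.GaloisRepresentations.ArtinConductor
import Literature.NumberTheory.Automorphic.GLnAdelicStructureProofs
import Literature.NumberTheory.Automorphic.LocalLanglandsGLProofs
import Literature.NumberTheory.Automorphic.LocalConstantsProofs
import Literature.NumberTheory.Automorphic.CertifiedMaassHeckeTraceCensus
import HarnessLib.Audit.Status.Attr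

/-!
Route: QuarterDeficit1951

DORMANT since 2026-08-26T15:42:17Z (reconciler: no traction for 6.2 d (last activity item-proof-filed at 2026-08-20T09:08:07Z); parked, not closed — `ledger route dormant route-Langlands-QuarterDeficit1951 --off` to reactivate) — unstaffed, not closed; items shared with open routes are served there. `ledger route dormant <id> --off` reactivates.

# Route QuarterDeficit1951 — certified spectral census at conductor 1951 can refute typed
reciprocity

NEGATION LENS, refutation shape (closes : CensusDeficit1951 → WindowFormDictionary → CensusDecoding
→ C2a → C2b → ¬Langlands; the window deficit C1 = QuarterFingerprintDeficit is DERIVED inside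
`closes` from the census items — judge-repair 2026-08-17). Taking the typed summit literally,
conjunct (B) at F = ℚ,
n = 2 applied to the ℓ-adic avatar of the Doud–Moore even icosahedral Artin representation of
conductor 1951 (the smallest conductor
of an even icosahedral representation, DoudMoore2006, BookerLeeStrombergsson2020 Thm 2) produces a
cuspidal L-algebraic π with
`Corresponds` at EVERY finite place; local–global compatibility pins the level to 1951 and the
finite determinant plus unitarity pin
π_∞ to the weight-0, λ = 1/4 principal series, so (C2a) the correspondent is a weight-0 Maass cusp
form on (Γ₀(1951), χ), χ of order 5,
whose Hecke eigenvalues carry the twist- and conjugation-invariant icosahedral fingerprint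
λ_p²·χ̄(p) ∈ Φ = {0, 1, 4, (3±√5)/2}. X (the
bet, C1) = for EVERY order-5 χ mod 1951 (typed ∀χ: C2a's conclusion does not track which order-5
character carries the correspondent, (B) applied to the four Doud–Moore representations predicts one
in EACH character, and window vacancy is conjugation-symmetric, so 'some χ' would only mean 'some
conjugate pair') NO nonzero weight-0 Maass cusp form with |λ − 1/4| ≤ 1/100 carries the fingerprint
within 1/100
at p ≤ 13 — a statement a Selberg–Hecke trace-formula computation in ball arithmetic settles EITHER
way; since 2026-08-17 its CERTIFICATE is the named crux CensusDeficit1951 (per χ a transcript of the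
landed format Literature.NumberTheory.Automorphic.CertifiedMaassHeckeTraceCensus with
`CertifiedMaassHeckeTraceCensus 1951 χ c ∧ c.certifiesDeficit = true`: upper count U_χ = 0 — empty
window, n = 1 traces only — or U_χ = 1 with the fingerprint certifiedly violated), decoded to C1 by
WindowFormDictionary + CensusDecoding (proof attached). CensusDeficit1951 ∧ WindowFormDictionary ∧
CensusDecoding ∧ C2a ∧ C2b → ¬Langlands (C2a, C2b PROVED).
Lean: `CensusDeficit1951 ∧ WindowFormDictionary ∧ CensusDecoding ∧ CorrespondentFingerprint ∧
IcosahedralSupply`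

## Assembly
Pure logic, refutation shape (`closes : CensusDeficit1951 → WindowFormDictionary → CensusDecoding →
CorrespondentFingerprint →
IcosahedralSupply → ¬Langlands`, re-certified 2026-08-17 against the amended Statement `∀ F,
Nonempty (ReciprocityData F) ∧ ∀ 𝓡 n …`): first QuarterFingerprintDeficit := CensusDecoding
CensusDeficit1951 WindowFormDictionary; then assume `Langlands`; specialise to F = ℚ, obtain a
reciprocity datum RD from the non-vacuity conjunct and the correspondence for THAT RD;
IcosahedralSupply at ℓ = 17 gives (ι, ρ)
geometric with the icosahedral hypotheses; conjunct (B) at n = 2 (hcpt :=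
isCompact_glFiniteIntegralLevel_holds 2 ℚ) gives a cuspidal
L-algebraic π with Corresponds RD ι π ρ; CorrespondentFingerprint turns it into an order-5 χ and a
fingerprinted λ = 1/4 Maass cusp form,
which QuarterFingerprintDeficit forbids (λ = 1/4 lies in the window and exact fingerprint membership
is within 1/100). The Assembly item
records the implication; the deciding theorem is `closes`, opened with --refutation (D-0027).

Rationale: WHY THIS LINE. All 37 open routes conclude `Langlands`; none attacks the negation, and the one
sector of the typed statement where a counterexample is
FINITELY DESCRIBABLE (conductor 1951, every a_p known from the A₅ quintic field) and ONE-SIDEDLY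
CERTIFIABLE is the even icosahedral
λ = 1/4 slice of (B) — invisible to every cohomological engine
(Literature.Barriers.Langlands.NonRegularWeightBarrier) but visible to the
Selberg trace formula. Booker–Strömbergsson / Booker–Lee–Strömbergsson (BookerStrombergsson2007,
arXiv:1803.06016 §5) evaluate the
trace formula for (Γ₀(N), χ) rigorously in Arb and used it as an UPPER-bound device ("no room for
further λ = 1/4 forms", conditional on
Artin); the presence of the predicted forms at N = 1951 has never been certified (their §1: the
unconditional form of Thm 2 "has not yet
been carried out"). The new lever is the LOWER-bound / moment extraction: with the window count
certified ≤ 1 per order-5 character, the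
ratios m_p/m_0 of Hecke traces ARE the window form's eigenvalues as certified intervals, and the
projective invariant λ_p²χ̄(p) (order of
Frob_p in A₅ ↦ 0, 1, 4, (3±√5)/2; independent of lift, twist, Galois conjugation and of the
rec-normalisation) decides: a missing or
mis-fingerprinted window form is a PROOF of ¬Langlands as typed; a fingerprinted one refutes C1 and
is the first certified spectral
sighting of the even icosahedral Maass forms. Imported: spectral theory of Γ₀(N)\ℍ (trace formula,
BLS numerics), class field theory
(determinants ↔ order-5 characters), projective A₅ character values; C2a additionally exercises the
summit's all-places clause
(conductor exactness through `LocalGlobalCompatibleAt`, Casselman1973 new vectors,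
DeligneSerreASENS1974 / Deligne1971 to exclude
weight-1 and weight ≥ 2 types without the omitted Hodge–Tate recipe).

RANKED CRUXES. (Judge-repair 2026-08-17: the census is now a NAMED crux and the window deficit is a
DERIVED target.) #2 CensusDeficit1951 (crux) — [computational bet, verdict class computation] for
every order-5 χ mod 1951 there is a transcript c : MaassHeckeTraceCensus (landed format
Literature.NumberTheory.Automorphic.CertifiedMaassHeckeTraceCensus: Arb boxes for the h-weighted
cuspidal Hecke traces m_n(h) of (Γ₀(1951), χ), BLS test function, certified window bounds) with
window ≥ 1/100, tolerance ≥ 1/100, fingerprint primes ⊆ {2,3,5,7,11,13}, which IS a certified census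
(`CertifiedMaassHeckeTraceCensus 1951 χ c`) and whose kernel-decidable verdict `c.certifiesDeficit`
is true: U_χ = ⌊m1hi/hlo⌋ = 0 (EMPTY window — needs only the n = 1 trace, i.e. the PUBLISHED BLS
formula, fpPrimes = []) or U_χ = 1 with λ_⋆(p)²χ̄(p) certifiedly off Φ at some p. [difficulty: L]
(why it might fail: Langlands true ⇒ only SIGHTING transcripts exist; and window multiplicity ≥ 2 —
a generic eigenvalue within the test function's resolution, Weyl ≈ 1.6 per χ in |r| ≤ 1/10 — yields
NO verdict in this format: the foreseen supersession is a v2 format with prime-power traces T_{p^k}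
(Prony separation of ≤ 3 lines).) [BookerLeeStrombergsson2020, 1803.06016, BookerStrombergsson2007,
Booker2003] #4 WindowFormDictionary (crux, routine M) — the inlined Maass predicate (two cusp
clauses) implies the census' IsMaassCuspFormOn 1951 χ u λ (period-1951 cuspidality at g·∞ for every
g ∈ SL₂(ℤ): g = γ·S·T^k with k ≡ d·c⁻¹ mod 1951 when 1951 ∤ c(g); S·T^1951·S⁻¹ ∈ Γ₀(1951)).
[Iwaniec2002, DiamondShurman2005] #5 CensusDecoding (crux, S, PROOF ATTACHED as evidence) —
CensusDeficit1951 → WindowFormDictionary → QuarterFingerprintDeficit by decoding theorem I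
`MaassHeckeTraceCensus.not_fingerprinted` + `maassHeckeOp_prime` (icosahedralFingerprint = Φ
verbatim). #0 QuarterFingerprintDeficit (target, DERIVED via CensusDecoding; still directly
provable/refutable) — [the window deficit] for every Dirichlet character χ mod 1951 of order 5 there
is NO nonzero bounded C² function u on ℍ with u(γz) = χ(d)u(z) on Γ₀(1951), Δu + λu = 0, |λ − 1/4| ≤
1/100, vanishing constant terms at both cusps (∞ of width 1, 0 of width 1951), that is a joint
eigenfunction of the classical T_p (p = 2,3,5,7,11,13; unitary normalisation, nebentypus χ) with
eigenvalues μ_p satisfying dist(μ_p²·χ̄(p), {0,1,4,(3±√5)/2}) ≤ 1/100. Settled by ONE kit job: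
Arb-certified Selberg–Hecke trace formula on (Γ₀(1951), χ) for the four order-5 χ (BLS formulas, M =
200, X ≤ 40), window upper count U_χ by the BLS quadratic form, lower count and eigenvalue intervals
λ_p = m_p/m_0 from the Hecke traces; TRUE-certificate (some χ with U_χ = 0, or U_χ = 1 and the
fingerprint violated) ⇒ with C2a, C2b: ¬Langlands; FALSE-certificate (all four χ carry a
fingerprinted window form) ⇒ route closes refuted:QuarterFingerprintDeficit with the sighting as
evidence. [difficulty: L] (why it might fail: Langlands is true: (B) for the four even icosahedral ρ
of conductor 1951 puts one fingerprinted λ = 1/4 newform in each order-5 character space (Booker's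
2005 non-rigorous coefficient test already favours this); the certified census then refutes C1.)
[BookerLeeStrombergsson2020, BookerStrombergsson2007, DoudMoore2006, Booker2003, Iwaniec2002]
#3 CorrespondentFingerprint (crux) — for ℓ ≥ 17, ℓ ≠ 1951, ι : ℚ̄_ℓ ≃ ℂ and any cuspidal L-algebraic
π of GL₂(𝔸_ℚ) with `Corresponds RD ι π ρ` (the summit's predicate: Satake matching a.e. AND
local–global compatibility at every finite place) for an irreducible, finite-image, EVEN ρ : Γ_ℚ →
GL₂(ℚ̄_ℓ) of Artin conductor 1951 whose unramified Frobenius char polys X² − tX + d have ι(d) =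
χ₀(p)⁻¹ (χ₀ mod 1951 of order 5) and t²/d ∈ {0,1,4, roots of x²−3x+1}: there is an order-5 character
χ mod 1951 and a nonzero weight-0 Maass cusp form u on (Γ₀(1951), χ) with λ = 1/4 EXACTLY, joint
T_p-eigenfunction (p ≤ 13) with μ_p²·χ̄(p) ∈ {0,1,4,(3±√5)/2}. Chain: unitarity of cuspidal π
(in-tree AutomorphicRepsGLCuspidalUnitary) ⇒ π_∞ ∈ {D_k-types, weight-1 PS(1,sgn), weight-0
PS(sgnᵃ,sgnᵃ)} up to |det|^s; finite-order det ρ + Satake matching kill s; D_k (k ≥ 2) killed by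
Deligne's ρ_f having infinite image vs ρ ≅ ρ_f (Chebotarev–Brauer–Nesbitt); weight 1 killed by
Deligne–Serre oddness vs ρ even; LGC at 1951 gives a(π_1951) = 1 (rec preserves conductors),
unramified elsewhere ⇒ Casselman new vector on K₀(1951) with character ⇒ classical newform by strong
approximation; T_p-eigenvalue λ_p = α+β, αβ = χ(p), and the arithmetic-Frobenius dictionary of
`SatakeFrobCompatibleAt` gives t²/d = ι⁻¹(λ_p² χ̄(p)). [difficulty: L] (why it might fail: as TYPED:
if the accepted `IsLocalLanglandsGL` lacks conductor (ε-factor) preservation or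
`CuspidalAutomorphicRepData` does not give unitarity of π_∞, a correspondent of level 1951² or with
π_∞ = PS(|·|ᵃ,|·|ᵇ), a ≠ b, fits the hypotheses and the λ = 1/4 / level pinning fails.)
[Casselman1973, DeligneSerreASENS1974, Deligne1971, Ribet1977, Gelbart1975, DiamondShurman2005,
BuzzardGeeLMS2014, HarrisTaylorAMS2001, Iwaniec2002]
#9 IcosahedralSupply (support) — [Doud–Moore supply, known in substance] for every reciprocity datum
RD of ℚ and every prime ℓ ≥ 17 there are ι : ℚ̄_ℓ ≃ ℂ and ρ : Γ_ℚ → GL₂(ℚ̄_ℓ) irreducible, finite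
image, even, Artin conductor 1951, geometric in the summit's sense (a.e. unramified; de Rham at ℓ
for the PINNED Fontaine datum — finite-image local representations are potentially unramified), with
an order-5 character χ₀ mod 1951 describing det at arithmetic Frobenius (ι d = χ₀(p)⁻¹) and
icosahedral Frobenius data t²/d ∈ {0,1,4, roots of x²−3x+1} at every v ≠ 1951. Witness: the totally
real A₅ quintic field of discriminant 1951⁴ (DoudMoore2006, exhaustive targeted Hunter search;
JonesRoberts2008 §4 for the method), Tate's lifting of its two projective representations to
conductor-1951 representations 1 ⊕ η on inertia (η of order 5), the twist by η̄ and the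
√5-conjugates: four representations, determinants the four order-5 characters; element orders in A₅
are 1,2,3,5, whence tr²/det ∈ {4,0,1,(3±√5)/2}. [difficulty: L] [DoudMoore2006, JonesRoberts2008,
BookerLeeStrombergsson2020, DeligneSerreASENS1974]

TWO-LAYER PLAN. If C1 is certified TRUE, CorrespondentFingerprint splits as ArchimedeanPinning (π_∞
is weight-0 λ = 1/4 from finite det + unitarity +
Deligne/Deligne–Serre) → LevelExactness (Corresponds at v = 1951 ⇒ conductor 1951 via the accepted
LLC) → NewformDictionary (Casselman +
strong approximation + T_p = α + β) → CorrespondentFingerprint (k = 3, depth 1). IcosahedralSupply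
splits as ArtinDeRhamPinned (finite-image
local reps are de Rham for the pinned Fontaine datum; reusable by every Artin-sector route) →
DoudMooreField (the quintic, its two projective
lifts, conductor and determinant bookkeeping) → IcosahedralSupply.

KILL CRITERIA. The census job returning, for all four order-5 χ, a window form with the fingerprint
(certified intervals) refutes QuarterFingerprintDeficit:
close `refuted:QuarterFingerprintDeficit`, attach the certificate as evidence (first certified
spectral sighting of the even icosahedral
Maass forms at 1951) and hand CorrespondentFingerprint / IcosahedralSupply to the even-Artin proof
routes (EvenArtinQuantumBoundary,
HolomorphicShadow, GaloisWeightedBE) as supports. A refutation of CorrespondentFingerprint by an API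
witness (non-unitary π_∞ or a
conductor-blind LLC datum) is a STATEMENT-AUDIT finding on `Corresponds`, not a pivot: report
needs-human. Even strong Artin proved for the
1951 representations (any route) moots the line.

NOT DECOMPOSED YET. CorrespondentFingerprint and IcosahedralSupply are PROVED (2026-08-17), so their
foreseen children are moot. The certificate FORMAT for C1 has LANDED
(Literature.NumberTheory.Automorphic.CertifiedMaassHeckeTraceCensus, sorry-free decoding theorems)
and C1 is now derived from CensusDeficit1951 + WindowFormDictionary via CensusDecoding; no in-kernel
checker of the Arb enclosures is claimed (verdict class: computation; `decide +kernel` evaluates the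
verdict on a transcribed census). Not filed: a χ-TRACKING supply/correspondent pair that would let
ONE vacant conjugate pair refute typed reciprocity (it would replace two proved items by two open
ones and only saves compute in the ¬Langlands world); a v2 certificate format tolerant of window
multiplicity 2–3 (prime-power traces) — file it if the first n = 1 run returns U_χ ≥ 2 for every χ.

CHEAPEST FALSIFIER. (a) Lookup, run: has the λ = 1/4 pair at conductor 1951 been certified present?
BookerLeeStrombergsson2020 §1/§5: only the upper-bound
criterion Q < 1 (subtracting the Artin-predicted count) was computed — presence is not certified;
Booker (J. Ramanujan Math. Soc. 20, 2005,
"Numerical tests of modularity") is a non-rigorous coefficient test. No certified sighting found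
(lit search / galaxy, 2026-08-16). (b) The
census job itself (≤ 2 days on the 980-core lane, below) settles C1 either way; not run this cycle
(it needs the BLS trace-formula evaluator
ported to the lane — engineering, not a lookup). (c) Cheapest first stage (2026-08-17): the n = 1
census alone (published BLS formula, no Hecke trace formula) for the two conjugate pairs — it
returns U_χ per character; U_χ = 0 anywhere discharges CensusDeficit1951 for that pair outright (the
judge's branch), U_χ = 1 sends the pair to the Hecke-trace stage, U_χ ≥ 2 everywhere sends the line
to the v2 format.

NUMBERS. Conductor 1951 = minimal prime (and, up to twist, minimal) conductor of an even icosahedral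
representation (DoudMoore2006; BookerLeeStrombergsson2020
Thm 2, complete to 2862 conditional on Artin); 1951 ≡ 1 mod 5, ≡ 1 mod 3, ≡ 7 mod 8, ≡ 3 mod 4 ⇒ at
level 1951: no even dihedral, no
octahedral, tetrahedral only in order-3/6 characters, icosahedral type 3a only (e = 5) ⇒ the order-5
character spaces carry exactly the
icosahedral prediction (one newform per character per A₅ field). Selberg verified for Γ₁(N), N ≤ 880
(BLS Thm 1); BLS numerics: M = 200,
X ≤ 40, class numbers h(t² ∓ 4n) for t ≤ e²⁰ (their [BBJ]). Window: |r| ≤ 0.1 (|λ − 1/4| ≤ 1/100);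
Weyl estimate vol(Γ₀(1951))/4π · r² ≈
163 r² ⇒ ≈ 1.6 generic eigenvalues expected in the window per character, removed by the six-prime
fingerprint (false-positive rate ≈ 10⁻⁷
under Sato–Tate). Job cost: ≈ 5·10⁹ class numbers of discriminants ≤ 10¹⁹ (n ∈ {1, 2, …, 13}), ≈ 10³
core-days ≈ 1–2 days on 980 cores;
assembly per character: hours. Items at open: 4; after the 2026-08-17 judge-repair: 7 (5 cruxes of
which 2 proved, 1 target, 1 assembly).

DEFINITION REQUESTS. compute-infra (to be filed after open): an Arb-certified evaluator of the
Selberg–Hecke trace formula for weight 0 on (Γ₀(N), χ) (port of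
the published BLS code, arXiv:1803.06016 [code]) emitting interval certificates for m_n = Σ_j h(r_j)
λ_n(u_j); verdict class `computation`
(no kernel checker claimed). No new Lean notions: IsC2, hypLaplacian
(Literature.NumberTheory.Automorphic.HyperbolicLaplaceSpectrum),
FramedGaloisRep.IsEven, GaloisRep.artinConductorNat, Corresponds, IsGeometricFramed all exist; the
Maass/Hecke predicates are inlined lets.

Novelty: Searches (2026-08-16): `lit search --source s2 "even icosahedral Galois representations prime
conductor"` (8; DoudMoore2006 read, pp. 2–8);
`lit search --source arxiv/zbmath "twist-minimal trace formulas Selberg eigenvalue conjecture"`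
(BLS20 read in full, §§1,4,5); `lit search
--source zbmath "Booker numerical tests of modularity"` (zbl:1122.11032); `lit search --hybrid "even
icosahedral representation conductor 1951
quintic polynomial"` (10, Buhler 1978 only relevant); `lit galaxy search "icosahedral Galois
representations of prime conductor" --star all` (2:
JonesRoberts2008 read, §4 Thm 4.1 — A₅-p fields to p ≤ 1553, the 1039 field of conductor 1039²);
`lean search Maass|IsMaassCuspForm|artinConductorNat|IsEven`;
all 37 open Langlands route headers read (no refutation route;
GaloisWeightedBE/EvenArtinQuantumBoundary/HolomorphicShadow are proof routes on the same slice).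
Nearest prior art found: BookerLeeStrombergsson2020 (arXiv:1803.06016) Thm 2 + §5 — certified trace
formula on (Γ₀(N), χ) used as an UPPER
bound on λ = 1/4 multiplicities up to conductor 2862, conditional on Artin; BookerStrombergsson2007;
Booker 2005 (non-rigorous modularity test).
Delta: point the certified trace formula the other way — a LOWER-bound / Hecke-moment census at the
first icosahedral conductor with the
twist-invariant projective fingerprint λ_p²χ̄(p) ∈ {0,1,4,(3±√5)/2}, wired through the typed
all-places `Corresponds` into a deciding theorem
for ¬Langlands: the summit's first refutation route  [refs: 1803.06016, DoudMoore2006, JonesRoberts2008, BookerLeeStrombergsson2020, BookerStrombergsson2007]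

Barriers (technique_class: certified-trace-formula, spectral-census, refutation): - technique_class: certified-trace-formula, spectral-census, refutation
- Literature.Barriers.Langlands.NonRegularWeightBarrier: evaded — nothing p-adic or cohomological is
used; the λ = 1/4 forms invisible to cohomology are exactly what the Selberg trace formula counts.
- Literature.Barriers.Langlands.SolvableImageBarrier: evaded — no base change; the insoluble (A₅)
case is met by a finite certified computation, and the fingerprint is built from A₅ element orders.
- Literature.Barriers.Langlands.ShimuraVarietyRealizationBarrier: not in this technique class (no
Galois representation is constructed from π; the route runs (B) and the classical dictionary π ↦
Maass newform).
- Literature.Barriers.Langlands.TaylorWilesNumericalCoincidence: not in this technique class (no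
patching).
- Negatives index: one entry (K3KugaSatakeDescent.SerreTypeAnchor, a prime-free-set typing kill);
steered around — every quantified prime set here is explicit ({2,3,5,7,11,13}, ℓ ≥ 17) and every
hypothesis speaks about the objects the conclusion uses.

History (route lifecycle, newest last):
- 2026-08-26T15:42:17Z · DORMANT — reconciler: no traction for 6.2 d (last activity item-proof-filed at 2026-08-20T09:08:07Z); parked, not closed — `ledger route dormant route-Langlands-QuarterDe (operator:999:2759180)

sub-problem: Langlands · status: dormant · opened planner-plan-lens-Langlands-negation-v2-0 2026-08-16T16:03:49Z · rev 6 · ledger route-Langlands-QuarterDeficit1951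
GENERATED by the gate from the ledger (D-0016/17). Provers cite these decls: `theorem foo : Summit.Langlands.Langlands.Theses.QuarterDeficit1951.<Decl> := …` in Summits/Langlands/Langlands/Theorems/<Name>.lean.
-/

namespace Summit.Langlands.Langlands.Theses.QuarterDeficit1951

open scoped BigOperators Topology Manifold Classical MeasureTheory ProbabilityTheory Matrix InnerProductSpace ComplexConjugate ContinuousMap
open Filter Set Function TopologicalSpace MeasureTheory

attribute [summit_statement] _root_.Langlands

/-- item stmt-Langlands-15897 · target · rank 2 · open · by planner
why it might fail: Langlands is true: (B) for the four even icosahedral ρ of conductor 1951 puts one fingerprinted λ = 1/4 newform in each order-5 character space (Booker's 2005 non-rigorous coefficient test already favours this); the certified census then refutes it.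
sources: BookerLeeStrombergsson2020, BookerStrombergsson2007, DoudMoore2006, Booker2003, Iwaniec2002
[crux] [computational bet] for every Dirichlet character χ mod 1951 of order 5 there is NO nonzero
bounded C² function u on ℍ with u(γz) = χ(d)u(z) on Γ₀(1951), Δu + λu = 0, |λ − 1/4| ≤ 1/100,
vanishing constant terms at both cusps (∞ of width 1, 0 of width 1951), that is a joint
eigenfunction of the classical T_p (p = 2,3,5,7,11,13; unitary normalisation, nebentypus χ) with
eigenvalues μ_p satisfying dist(μ_p²·χ̄(p), {0,1,4,(3±√5)/2}) ≤ 1/100. Settled by ONE kit job: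
Arb-certified Selberg–Hecke trace formula on (Γ₀(1951), χ) for the four order-5 χ (BLS formulas, M =
200, X ≤ 40), window upper count U_χ by the BLS quadratic form, lower count and eigenvalue intervals
λ_p = m_p/m_0 from the Hecke traces; TRUE-certificate (some χ with U_χ = 0, or U_χ = 1 and the
fingerprint violated) ⇒ with C2a, C2b: ¬Langlands; FALSE-certificate (all four χ carry a
fingerprinted window form) ⇒ route closes refuted:QuarterFingerprintDeficit with the sighting as
evidence. [difficulty: L] -/
@[route_item "route-Langlands-QuarterDeficit1951"]
def QuarterFingerprintDeficit : Prop :=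
  let Φ : Set ℂ := {0, 1, 4, (((3 + Real.sqrt 5) / 2 : ℝ) : ℂ), (((3 - Real.sqrt 5) / 2 : ℝ) : ℂ)}; let P₀ : Finset ℕ := {2, 3, 5, 7, 11, 13}; let IsForm : DirichletCharacter ℂ 1951 → (UpperHalfPlane → ℂ) → ℝ → Prop := fun χ u lam => Literature.NumberTheory.Automorphic.IsC2 u ∧ (∀ z, Literature.NumberTheory.Automorphic.hypLaplacian u z + (lam : ℂ) * u z = 0) ∧ (∀ γ : Matrix.SpecialLinearGroup (Fin 2) ℤ, γ ∈ CongruenceSubgroup.Gamma0 1951 → ∀ z : UpperHalfPlane, u (γ • z) = χ ((γ 1 1 : ℤ) : ZMod 1951) * u z) ∧ (∀ y : ℝ, 0 < y → ∫ x in (0 : ℝ)..1, u (UpperHalfPlane.ofComplex (x + y * Complex.I)) = 0) ∧ (∀ y : ℝ, 0 < y → ∫ x in (0 : ℝ)..1951, u (ModularGroup.S • UpperHalfPlane.ofComplex (x + y * Complex.I)) = 0) ∧ (∃ C : ℝ, ∀ z, ‖u z‖ ≤ C); let Tp : DirichletCharacter ℂ 1951 → ℕ → (UpperHalfPlane → ℂ)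 → UpperHalfPlane → ℂ := fun χ p u z => ((Real.sqrt p : ℝ) : ℂ)⁻¹ * ((∑ b ∈ Finset.range p, u (UpperHalfPlane.ofComplex (((z : ℂ) + b) / p))) + χ (p : ZMod 1951) * u (UpperHalfPlane.ofComplex ((p : ℂ) * z))); ∀ χ : DirichletCharacter ℂ 1951, orderOf χ = 5 → ¬ ∃ (u : UpperHalfPlane → ℂ) (lam : ℝ), IsForm χ u lam ∧ (∃ z, u z ≠ 0) ∧ |lam - 1 / 4| ≤ 1 / 100 ∧ ∀ p ∈ P₀, ∃ μ φ : ℂ, φ ∈ Φ ∧ (∀ z, Tp χ p u z = μ * u z) ∧ ‖μ ^ 2 * (starRingEnd ℂ) (χ (p : ZMod 1951)) - φ‖ ≤ 1 / 100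

/-- item stmt-Langlands-17933 · crux · rank 2 · open · by planner
why it might fail: Langlands true ⇒ each order-5 χ carries the fingerprinted λ=1/4 icosahedral newform, so only SIGHTING transcripts exist (parent refuted); and even if the parent holds, a 2nd eigenvalue with |r| ≤ 1/10 (Weyl ≈ 1.6 per χ) gives U_χ ≥ 2: no verdict in this format (needs T_{p²} traces).
sources: BookerLeeStrombergsson2020, 1803.06016, BookerStrombergsson2007, Booker2003, Iwaniec2002
[crux][computational bet; verdict class computation — the judge's census as a NAMED item] for every
Dirichlet character χ mod 1951 of order 5 there is a transcript c : MaassHeckeTraceCensus (landed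
format Literature.NumberTheory.Automorphic.CertifiedMaassHeckeTraceCensus: Arb boxes for the
h-weighted cuspidal Hecke traces m_n(h) = Σ_j h(r_j)λ_j(n) of (Γ₀(1951), χ), BLS test function h,
certified window bounds hlo ≤ h ≤ hhi) with window ≥ 1/100, tolerance ≥ 1/100 and fingerprint primes
⊆ {2,3,5,7,11,13}, which IS a certified census of the weight-0 cuspidal spectrum
(`CertifiedMaassHeckeTraceCensus 1951 χ c`) and whose kernel-decidable verdict `c.certifiesDeficit`
is true: upper count U_χ = ⌊m1hi/hlo⌋ = 0 (EMPTY window |λ − 1/4| ≤ 1/100 — the judge's branch; it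
needs the n = 1 trace only, i.e. the published BLS formula Thm 7 with fpPrimes = [], no Hecke trace
formula) or U_χ = 1 with λ_⋆(p)²·χ̄(p) certifiedly farther than fpTol from Φ = {0,1,4,(3±√5)/2} at
some p. One kit job per conjugate pair {χ, χ̄} (vacancy and traces are conjugation-symmetric); the
transcript is printed as a Lean literal, `decide +kernel` evaluates the verdict, the Arb log is the
evidence. TRUE-certificates for -/
@[route_item "route-Langlands-QuarterDeficit1951", crux]
def CensusDeficit1951 : Prop :=
  ∀ χ : DirichletCharacter ℂ 1951, orderOf χ = 5 → ∃ c : Literature.NumberTheory.Automorphic.MaassHeckeTraceCensus, (1 / 100 : ℚ) ≤ c.window ∧ (1 / 100 : ℚ) ≤ c.fpTol ∧ (∀ p ∈ c.fpPrimes, p ∈ ({2, 3, 5, 7, 11, 13} : Finset ℕ)) ∧ Literature.NumberTheory.Automorphic.CertifiedMaassHeckeTraceCensus 1951 χ c ∧ c.certifiesDeficit = true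

/-- item stmt-Langlands-15898 · crux · rank 3 · closed · proved by Summit.Langlands.Langlands.Theorems.CorrespondentFingerprint.CorrespondentFingerprint_proof @ 59ff85e4030e (prover) · by planner
why it might fail: as TYPED: if the accepted `IsLocalLanglandsGL` lacks conductor (ε-factor) preservation or `CuspidalAutomorphicRepData` does not give unitarity of π_∞, a correspondent of level 1951² or with π_∞ = PS(|·|ᵃ,|·|ᵇ), a ≠ b, fits the hypotheses and the λ = 1/4 / level pinning fails.
sources: Casselman1973, DeligneSerreASENS1974, Deligne1971, Ribet1977, Gelbart1975, DiamondShurman2005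
[crux] for ℓ ≥ 17, ℓ ≠ 1951, ι : ℚ̄_ℓ ≃ ℂ and any cuspidal L-algebraic π of GL₂(𝔸_ℚ) with
`Corresponds RD ι π ρ` (the summit's predicate: Satake matching a.e. AND local–global compatibility
at every finite place) for an irreducible, finite-image, EVEN ρ : Γ_ℚ → GL₂(ℚ̄_ℓ) of Artin conductor
1951 whose unramified Frobenius char polys X² − tX + d have ι(d) = χ₀(p)⁻¹ (χ₀ mod 1951 of order 5)
and t²/d ∈ {0,1,4, roots of x²−3x+1}: there is an order-5 character χ mod 1951 and a nonzero
weight-0 Maass cusp form u on (Γ₀(1951), χ) with λ = 1/4 EXACTLY, joint T_p-eigenfunction (p ≤ 13)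
with μ_p²·χ̄(p) ∈ {0,1,4,(3±√5)/2}. Chain: unitarity of cuspidal π (in-tree
AutomorphicRepsGLCuspidalUnitary) ⇒ π_∞ ∈ {D_k-types, weight-1 PS(1,sgn), weight-0 PS(sgnᵃ,sgnᵃ)} up
to |det|^s; finite-order det ρ + Satake matching kill s; D_k (k ≥ 2) killed by Deligne's ρ_f having
infinite image vs ρ ≅ ρ_f (Chebotarev–Brauer–Nesbitt); weight 1 killed by Deligne–Serre oddness vs ρ
even; LGC at 1951 gives a(π_1951) = 1 (rec preserves conductors), unramified elsewhere ⇒ Casselman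
new vector on K₀(1951) with character ⇒ classical newform by strong approximation; T_p-eigenvalue
λ_p = α+β, αβ = χ(p), and the arithmetic-F -/
@[route_item "route-Langlands-QuarterDeficit1951", crux]
def CorrespondentFingerprint : Prop :=
  let Φ : Set ℂ := {0, 1, 4, (((3 + Real.sqrt 5) / 2 : ℝ) : ℂ), (((3 - Real.sqrt 5) / 2 : ℝ) : ℂ)}; let P₀ : Finset ℕ := {2, 3, 5, 7, 11, 13}; let IsForm : DirichletCharacter ℂ 1951 → (UpperHalfPlane → ℂ) → ℝ → Prop := fun χ u lam => Literature.NumberTheory.Automorphic.IsC2 u ∧ (∀ z, Literature.NumberTheory.Automorphic.hypLaplacian u z + (lam : ℂ) * u z = 0) ∧ (∀ γ : Matrix.SpecialLinearGroup (Fin 2) ℤ, γ ∈ CongruenceSubgroup.Gamma0 1951 → ∀ z : UpperHalfPlane, u (γ • z) = χ ((γ 1 1 : ℤ) : ZMod 1951) * u z) ∧ (∀ y : ℝ, 0 < y → ∫ x in (0 : ℝ)..1, u (UpperHalfPlane.ofComplex (x + y * Complex.I)) = 0) ∧ (∀ y : ℝ, 0 < y → ∫ x in (0 : ℝ)..1951,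 u (ModularGroup.S • UpperHalfPlane.ofComplex (x + y * Complex.I)) = 0) ∧ (∃ C : ℝ, ∀ z, ‖u z‖ ≤ C); let Tp : DirichletCharacter ℂ 1951 → ℕ → (UpperHalfPlane → ℂ) → UpperHalfPlane → ℂ := fun χ p u z => ((Real.sqrt p : ℝ) : ℂ)⁻¹ * ((∑ b ∈ Finset.range p, u (UpperHalfPlane.ofComplex (((z : ℂ) + b) / p))) + χ (p : ZMod 1951) * u (UpperHalfPlane.ofComplex ((p : ℂ) * z))); ∀ (RD : Summit.Langlands.ReciprocityData ℚ) (ℓ : ℕ) [Fact ℓ.Prime] (ι : PadicAlgCl ℓ ≃+* ℂ) (hcpt : Literature.NumberTheory.Automorphic.isCompact_glFiniteIntegralLevel 2 ℚ) (π : Literature.NumberTheory.Automorphic.CuspidalAutomorphicRepData 2 ℚ hcpt) (ρ : Literature.NumberTheory.GaloisRepresentations.FramedGaloisRep ℚ (PadicAlgCl ℓ) 2), 17 ≤ ℓ → ℓ ≠ 1951 → (ρ.toGaloisRep.IsIrreducible ∧ (Set.range ρ).Finite ∧ ρ.IsEven ∧ ρ.toGaloisRep.artinConductorNat = 1951 ∧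 ∃ χ₀ : DirichletCharacter ℂ 1951, orderOf χ₀ = 5 ∧ ∀ v : IsDedekindDomain.HeightOneSpectrum (NumberField.RingOfIntegers ℚ), v.residueCard ≠ 1951 → ρ.IsUnramifiedAt v ∧ ∃ t d : PadicAlgCl ℓ, ρ.HasFrobCharpolyAt v (Polynomial.X ^ 2 - Polynomial.C t * Polynomial.X + Polynomial.C d) ∧ ι d = (χ₀ (v.residueCard : ZMod 1951))⁻¹ ∧ (t ^ 2 = 0 ∨ t ^ 2 = d ∨ t ^ 2 = 4 * d ∨ t ^ 4 - 3 * d * t ^ 2 + d ^ 2 = 0)) → π.1.IsLAlgebraic → Summit.Langlands.Corresponds RD ι π.1 ρ → ∃ χ : DirichletCharacter ℂ 1951, orderOf χ = 5 ∧ ∃ u : UpperHalfPlane → ℂ, IsForm χ u (1 / 4) ∧ (∃ z, u z ≠ 0) ∧ ∀ p ∈ P₀, ∃ μ φ : ℂ, φ ∈ Φ ∧ (∀ z, Tp χ p u z = μ * u z) ∧ μ ^ 2 * (starRingEnd ℂ) (χ (p : ZMod 1951)) = φ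

-- `CorrespondentFingerprint` holds: proved by `Summit.Langlands.Langlands.Theorems.CorrespondentFingerprint.CorrespondentFingerprint_proof` @ 59ff85e4030e (its module imports this route file, so no `_holds` link can be stated here).

/-- item stmt-Langlands-17934 · crux · rank 4 · closed · proved by Summit.Langlands.Langlands.Theorems.QuarterDeficit1951.WindowFormDictionary_proof @ 6220c4f91f65 (prover) · by planner
why it might fail: as TYPED only: the all-cusps period-1951 cuspidality of IsMaassCuspFormOn must follow from the two inlined cusp clauses; breaks if the SL(2,ℤ)-action / ofComplex conventions differ from the inlined ones (g•ofComplex(x+k+iy) vs T^k) or IsC2 gives no continuity for the interval-integral shift.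
sources: Iwaniec2002, BookerLeeStrombergsson2020, DiamondShurman2005
[crux][routine dictionary, M; a binder of `closes`, hence crux-kinded] the route's inlined
Maass-form predicate IsForm (C², Δu+λu = 0, weight-0 χ-automorphy on Γ₀(1951), vanishing constant
terms at ∞ (period 1) and at 0 (period 1951 after S), bounded) implies the census'
`IsMaassCuspFormOn 1951 χ u λ`, whose only extra content is cuspidality as the period-1951 condition
at g·∞ for EVERY g ∈ SL₂(ℤ): if 1951 ∤ c(g) write g = γ·S·T^k with k ≡ d·c⁻¹ (mod 1951), γ =
g·T^{−k}·S⁻¹ ∈ Γ₀(1951) with d-entry c, so u(g(x+iy)) = χ(c)·u(S((x+k)+iy)) and x ↦ u(S(x+iy)) is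
1951-periodic (S·T^1951·S⁻¹ = (1 0; −1951 1) ∈ Γ₀(1951), d-entry 1); if 1951 | c(g) then g ∈
Γ₀(1951) and 1-periodicity gives ∫₀^1951 = 1951·∫₀^1 = 0. Continuity from IsC2 makes the interval
integrals shift-invariant (Function.Periodic.intervalIntegral_add_eq). No order-5 hypothesis needed. -/
@[route_item "route-Langlands-QuarterDeficit1951", crux]
def WindowFormDictionary : Prop :=
  ∀ (χ : DirichletCharacter ℂ 1951) (u : UpperHalfPlane → ℂ) (lam : ℝ), Literature.NumberTheory.Automorphic.IsC2 u → (∀ z, Literature.NumberTheory.Automorphic.hypLaplacian u z + (lam : ℂ) * u z = 0) → (∀ γ : Matrix.SpecialLinearGroup (Fin 2) ℤ, γ ∈ CongruenceSubgroup.Gamma0 1951 → ∀ z : UpperHalfPlane, u (γ • z) = χ ((γ 1 1 : ℤ) : ZMod 1951) * u z) → (∀ y : ℝ, 0 < y → ∫ x in (0 : ℝ)..1, u (UpperHalfPlane.ofComplex (x + y * Complex.I)) = 0) → (∀ y : ℝ, 0 < y → ∫ x in (0 : ℝ)..1951, u (ModularGroup.S • UpperHalfPlane.ofComplex (x + y *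 Complex.I)) = 0) → (∃ C : ℝ, ∀ z, ‖u z‖ ≤ C) → Literature.NumberTheory.Automorphic.IsMaassCuspFormOn 1951 χ u lam

-- `WindowFormDictionary` holds: proved by `Summit.Langlands.Langlands.Theorems.QuarterDeficit1951.WindowFormDictionary_proof` @ 6220c4f91f65 (its module imports this route file, so no `_holds` link can be stated here).

/-- item stmt-Langlands-17935 · crux · rank 5 · closed · proved by Summit.Langlands.Langlands.Theorems.QuarterDeficit1951.CensusDecoding_proof @ 25ebc7474e19 (prover) · by planner
why it might fail: none substantive — a sorry-free proof is attached (Sketch.lean, lean check rc 0); as TYPED it fails only if the gate renders the two antecedent items differently from the checked mock (namespace / opens), i.e. a transcription slip.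
sources: BookerLeeStrombergsson2020, Moore1966, Iwaniec2002
[crux][decoding glue, S — PROOF ATTACHED] the certified deficit transcripts and the dictionary give
the window deficit: unpack a hypothetical fingerprinted window form for an order-5 χ; the dictionary
makes it an `IsMaassCuspFormOn 1951 χ u λ`; `maassHeckeOp_prime` turns the pointwise T_p-relations
into `maassHeckeOp 1951 χ p u = μ_p • u`; decoding theorem I
`MaassHeckeTraceCensus.not_fingerprinted` on the transcript yields p ∈ fpPrimes ⊆ {2,3,5,7,11,13}
with fpTol < ‖μ_p²·χ̄(p) − φ‖ for every φ ∈ icosahedralFingerprint (= the route's Φ verbatim),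
contradicting ≤ 1/100 ≤ fpTol (and |λ − 1/4| ≤ 1/100 ≤ window). A sorry-free proof (lean check rc 0
against the rendered item texts) is attached as evidence (Sketch.lean, theorem
QuarterFingerprintDeficit_of_census): land it verbatim as `theorem … :
Summit.Langlands.Langlands.Theses.QuarterDeficit1951.CensusDecoding`. With it
QuarterFingerprintDeficit is DERIVED from the two census items. -/
@[route_item "route-Langlands-QuarterDeficit1951", crux]
def CensusDecoding : Prop :=
  CensusDeficit1951 → WindowFormDictionary → QuarterFingerprintDeficit

-- `CensusDecoding` holds: proved by `Summit.Langlands.Langlands.Theorems.QuarterDeficit1951.CensusDecoding_proof` @ 25ebc7474e19 (its module imports this route file, so no `_holds` link can be stated here).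

/-- item stmt-Langlands-15899 · crux · rank 9 · closed · proved by Summit.Langlands.Langlands.Theorems.QuarterDeficit1951.IcosahedralSupply_proof @ 84f6e23026c3 (prover) · by planner
why it might fail: as TYPED: IsGeometricFramed asks de Rham-ness of the finite-image ρ at ℓ for the PINNED Fontaine datum (Hilbert-ε over IsFontaineDatum): unprovable or false if FontaineDatumExists fails or the spec omits admissibility of potentially unramified reps; artinConductorNat must give exponent 1 at 1951.
sources: DoudMoore2006, JonesRoberts2008, FontaineAsterisque223III, DeligneSerreASENS1974
[support] [Doud–Moore supply, known in substance] for every reciprocity datum RD of ℚ and every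
prime ℓ ≥ 17 there are ι : ℚ̄_ℓ ≃ ℂ and ρ : Γ_ℚ → GL₂(ℚ̄_ℓ) irreducible, finite image, even, Artin
conductor 1951, geometric in the summit's sense (a.e. unramified; de Rham at ℓ for the PINNED
Fontaine datum — finite-image local representations are potentially unramified), with an order-5
character χ₀ mod 1951 describing det at arithmetic Frobenius (ι d = χ₀(p)⁻¹) and icosahedral
Frobenius data t²/d ∈ {0,1,4, roots of x²−3x+1} at every v ≠ 1951. Witness: the totally real A₅
quintic field of discriminant 1951⁴ (DoudMoore2006, exhaustive targeted Hunter search;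
JonesRoberts2008 §4 for the method), Tate's lifting of its two projective representations to
conductor-1951 representations 1 ⊕ η on inertia (η of order 5), the twist by η̄ and the
√5-conjugates: four representations, determinants the four order-5 characters; element orders in A₅
are 1,2,3,5, whence tr²/det ∈ {4,0,1,(3±√5)/2}. [difficulty: L] -/
@[route_item "route-Langlands-QuarterDeficit1951", crux]
def IcosahedralSupply : Prop :=
  ∀ (RD : Summit.Langlands.ReciprocityData ℚ) (ℓ : ℕ) [Fact ℓ.Prime], 17 ≤ ℓ → ∃ (ι : PadicAlgCl ℓ ≃+* ℂ) (ρ : Literature.NumberTheory.GaloisRepresentations.FramedGaloisRep ℚ (PadicAlgCl ℓ) 2), Summit.Langlands.IsGeometricFramed RD ρ ∧ (ρ.toGaloisRep.IsIrreducible ∧ (Set.range ρ).Finite ∧ ρ.IsEven ∧ ρ.toGaloisRep.artinConductorNat = 1951 ∧ ∃ χ₀ : DirichletCharacter ℂ 1951, orderOf χ₀ = 5 ∧ ∀ v : IsDedekindDomain.HeightOneSpectrum (NumberField.RingOfIntegers ℚ), v.residueCard ≠ 1951 → ρ.IsUnramifiedAt v ∧ ∃ t d : PadicAlgCl ℓ,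 ρ.HasFrobCharpolyAt v (Polynomial.X ^ 2 - Polynomial.C t * Polynomial.X + Polynomial.C d) ∧ ι d = (χ₀ (v.residueCard : ZMod 1951))⁻¹ ∧ (t ^ 2 = 0 ∨ t ^ 2 = d ∨ t ^ 2 = 4 * d ∨ t ^ 4 - 3 * d * t ^ 2 + d ^ 2 = 0))

-- `IcosahedralSupply` holds: proved by `Summit.Langlands.Langlands.Theorems.QuarterDeficit1951.IcosahedralSupply_proof` @ 84f6e23026c3 (its module imports this route file, so no `_holds` link can be stated here).

/-- item stmt-Langlands-15900 · assembly · rank 1 · closed · proved by Summit.Langlands.Langlands.Theorems.QuarterDeficit1951.Assembly_proof @ 8785077e6c5f (prover) · by planner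
sources: BuzzardGeeLMS2014, DoudMoore2006, BookerLeeStrombergsson2020
[assembly] QuarterFingerprintDeficit → CorrespondentFingerprint → IcosahedralSupply → ¬ Langlands
(refutation shape; the deciding theorem `closes` proves exactly this). -/
@[route_item "route-Langlands-QuarterDeficit1951"]
def Assembly : Prop :=
  QuarterFingerprintDeficit → CorrespondentFingerprint → IcosahedralSupply → ¬ _root_.Langlands

-- `Assembly` holds: proved by `Summit.Langlands.Langlands.Theorems.QuarterDeficit1951.Assembly_proof` @ 8785077e6c5f (its module imports this route file, so no `_holds` link can be stated here).

/-! D-0027 §2.1 — DECIDING THEOREM (planner-authored via `route open/edit --closes-file`; by planner-rrepair-Langlands-QuarterDeficit1951-j-a2d2d30e-0 2026-08-17T08:51:59Z):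
its hypotheses are this route's items and its conclusion the sub-problem Statement (glue_lint), and it elaborates with this file. -/

@[closes "route-Langlands-QuarterDeficit1951"] theorem closes (h₁ : CensusDeficit1951) (h₂ : WindowFormDictionary) (h₃ : CensusDecoding)
    (h₄ : CorrespondentFingerprint) (h₅ : IcosahedralSupply) : ¬ _root_.Langlands := by
  -- Step 1 (decoding the census): the glue item turns the certified deficit transcripts and the
  -- Maass-form dictionary into the window deficit `QuarterFingerprintDeficit` (derived target).
  have h₀ : QuarterFingerprintDeficit := h₃ h₁ h₂
  -- Step 2 (the refutation, re-certified against the Statement as amended 2026-08-17: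
  -- `∀ F, Nonempty (ReciprocityData F) ∧ ∀ 𝓡 n, 0 < n → ∀ hcpt, GlobalLanglandsCorrespondenceGLn n F 𝓡 hcpt`):
  -- specialise to F = ℚ, any reciprocity datum, n = 2, the Doud–Moore supply at ℓ = 17, and the
  -- correspondent's fingerprinted λ = 1/4 form, which the window deficit forbids.
  intro hL
  obtain ⟨⟨RD⟩, hRD⟩ := hL ℚ
  haveI : Fact (Nat.Prime 17) := ⟨by norm_num⟩
  obtain ⟨ι, ρ, hgeo, hyp⟩ := h₅ RD 17 le_rfl
  have hB := (hRD RD 2 (by norm_num)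
    (Literature.NumberTheory.Automorphic.isCompact_glFiniteIntegralLevel_holds 2 ℚ)).2
  obtain ⟨π, hLalg, hcorr⟩ := hB 17 ι ρ hyp.1 hgeo
  obtain ⟨χ, hχ, u, hform, hne, hfp⟩ := h₄ RD 17 ι _ π ρ le_rfl (by norm_num) hyp hLalg hcorr
  refine h₀ χ hχ ⟨u, 1 / 4, hform, hne, by norm_num, fun p hp => ?_⟩
  obtain ⟨μ, φ, hφ, hT, hμ⟩ := hfp p hp
  exact ⟨μ, φ, hφ, hT, by rw [hμ, sub_self, norm_zero]; norm_num⟩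

end Summit.Langlands.Langlands.Theses.QuarterDeficit1951
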